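import Literature.NumberTheory.LFunctions.ProlateExistsUnique
import Literature.NumberTheory.ConnesConsani2021.TraceRemainderEpsilon
import Literature.NumberTheory.ConnesConsani2021.ProlateProjections
import HarnessLib

/-!
# Connes–Consani 2021, Lemma 5.4 numerics: the prolate data `λ(k)`, `ψ_k(1)²`, `t(k)` READ OFF the
# principal Frobenius solution (the bridge a kernel certificate uses; PROVED, no numerics)

RH-FREE corpus literature (label, line 1): bookkeeping identities between the tree prolate vectors
`prolateFun k` and the principal Frobenius solution `u_b = frobSol 1 b` of the prolate equation at a
critical parameter `b` (`u_b′(0) = 0`); nothing in this file mentions `ζ`, the critical strip or RH,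
and nothing here bears on the truth of RH.  bears_on (cell rh-crit, corpus C1): apex input (B) —
route «ConnesConsaniSemilocal» item K2 `DensitySlope` (stmt 19308), the (E-b) conjunct
`22.9 ≤ Σ' t(n) ≤ 23.1` of `CC2021_section6_enclosures` (tier 2 of cc R70: the kernel certificate).

Sources: A. Connes, C. Consani, *Weil positivity and trace formula, the archimedean place*, Selecta
Math. (N.S.) 27 (2021) 77 = arXiv:2006.13771 [bib `ConnesConsani2021`], Lemma 5.4 §5 pp. 32–33
(arXiv item Lemma 31: `ε′(1⁺) = Σ λ(n)²(1−λ(n)²)⁻¹ξ_n(1)²·2`, "`≃ 22.9965`"); the shooting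
construction of the tree (`ProlateExistence.lean`, [Slepian–Pollak 1961, §III],
[Connes–Consani–Moscovici 2025, §7 (7.9)–(7.12)], [Coddington–Levinson 1955, Ch. 8 §2]).

## What is here (all PROVED, 0 definitions, 0 facts)

* `isProlateFunction_frobSol_evenExt` — the tree's even-extension theorem
  `exists_isProlateFunction_of_frobSol` with the witness EXPOSED: for `u_b′(0) = 0` and `k` zeros of
  `u_b` in `(0,λ)`, the explicit function `x ↦ C_b·u_b(|x|)·𝟙_{|x|≤λ}`,
  `C_b = ±1/√(2∫₀^λ u_b²)`, is `IsProlateFunction λ (2k)`, AND it satisfies the eigen-equation with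
  `χ = b` (`frobSol_evenExt_eigen`);
* for `λ = 1`, by uniqueness (`eq_prolateFun_of_isProlateFunction`): `prolateFun_eq_evenExt`,
  **`prolateEigen_eq_of_frobSol`** (`λ(k) = 2∫₀¹u_b / u_b(0)`),
  **`prolateFun_one_sq_eq_of_frobSol`** (`ψ_k(1)² = 1/(2∫₀¹u_b²)`),
  **`epsSlopeTerm_prolateFun_eq_of_frobSol`** (`t(k)` in these terms),
  and **`ne_of_frobSol_critical`** (distinct critical parameters give distinct indices) — so a
  certificate never needs to COUNT zeros: four distinct certified critical `b`'s are four distinct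
  members, whatever their indices.

WHAT THIS IS NOT: no enclosure is computed here; no statement about `ζ` or RH.
-/

noncomputable section

open Real Set Filter Topology MeasureTheory

namespace Literature.NumberTheory.LFunctions

variable {lam : ℝ}

/-- **Even extension, witness exposed** (the tree's `exists_isProlateFunction_of_frobSol` with the
explicit function and constant): if `u_b′(0) = 0` and `u_b` has `k` zeros in `(0, λ)`, then
`x ↦ C·u_b(|x|)·𝟙_{|x| ≤ λ}` with `C = s/√(2∫₀^λu_b²)`, `s = sign u_b(0)`, is a prolate function
with `2k` zeros. [cite: SlepianPollak1961, §III; ConnesConsaniMoscovici2025, §7 (7.9)–(7.12)] -/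
theorem isProlateFunction_frobSol_evenExt (hlam : 0 < lam) {b : ℝ} {k : ℕ}
    (hB : frobSol₁ lam b 0 = 0) (hN : {x | x ∈ Ioo 0 lam ∧ frobSol lam b x = 0}.ncard = k) :
    IsProlateFunction lam (2 * k) (fun x ↦ if |x| ≤ lam then
      (if 0 < frobSol lam b 0 then 1 else -1)
        / Real.sqrt (2 * ∫ x in (0 : ℝ)..lam, frobSol lam b x ^ 2) * frobSol lam b |x| else 0) ∧
    ∀ x ∈ Ioo (-lam) lam,
      -(deriv (fun y ↦ (lam ^ 2 - y ^ 2) * deriv (fun x ↦ if |x| ≤ lam then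
          (if 0 < frobSol lam b 0 then 1 else -1)
            / Real.sqrt (2 * ∫ x in (0 : ℝ)..lam, frobSol lam b x ^ 2) * frobSol lam b |x|
          else 0) y) x)
        + (2 * π * lam * x) ^ 2 * (if |x| ≤ lam then
          (if 0 < frobSol lam b 0 then 1 else -1)
            / Real.sqrt (2 * ∫ x in (0 : ℝ)..lam, frobSol lam b x ^ 2) * frobSol lam b |x|
          else 0)
        = b * (if |x| ≤ lam then
          (if 0 < frobSol lam b 0 then 1 else -1)
            / Real.sqrt (2 * ∫ x in (0 : ℝ)..lam, frobSol lam b x ^ 2) * frobSol lam b |x|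
          else 0) := by
  have h0mem : (0 : ℝ) ∈ Ioo (-lam) lam := ⟨by linarith, hlam⟩
  have hA : frobSol lam b 0 ≠ 0 := fun h ↦ frobSol₁_ne_zero_of_zero hlam b h0mem h hB
  have heven := fun x (hx : x ∈ Ioo (-lam) lam) ↦ frobSol_neg_eq hlam hB hx
  have hcont := continuousOn_frobSol_Icc hlam b
  have hsol := isProlateODESol_frobSol hlam b
  -- normalisation constants
  set I := ∫ x in (0 : ℝ)..lam, frobSol lam b x ^ 2 with hI
  have hIpos : 0 < I := integral_frobSol_sq_pos hlam b
  set s : ℝ := if 0 < frobSol lam b 0 then 1 else -1 with hs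
  have hs1 : s ^ 2 = 1 := by rw [hs]; split_ifs <;> norm_num
  have hsA : 0 < s * frobSol lam b 0 := by
    rw [hs]; split_ifs with h
    · simpa using h
    · have : frobSol lam b 0 < 0 := lt_of_le_of_ne (not_lt.mp h) hA
      linarith
  set C : ℝ := s / Real.sqrt (2 * I) with hC
  have hsqrt : 0 < Real.sqrt (2 * I) := Real.sqrt_pos.mpr (by positivity)
  have hC2 : C ^ 2 * (2 * I) = 1 := by
    rw [hC, div_pow, hs1, Real.sq_sqrt (by positivity)]
    field_simp
  have hC0 : C ≠ 0 := by
    intro h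
    rw [h] at hC2
    simp at hC2
  -- the function
  set f : ℝ → ℝ := fun x ↦ if |x| ≤ lam then C * frobSol lam b |x| else 0 with hf
  have hfIoc : ∀ x ∈ Ioc (-lam) lam, f x = C * frobSol lam b x := by
    intro x hx
    have hxabs : |x| ≤ lam := abs_le.mpr ⟨hx.1.le, hx.2⟩
    simp only [hf, if_pos hxabs]
    rcases le_or_gt 0 x with h | h
    · rw [abs_of_nonneg h]
    · rw [abs_of_neg h, heven x ⟨hx.1, by linarith⟩]
  have hfIco : ∀ x ∈ Ico (-lam) lam, f x = C * frobSol lam b (-x) := by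
    intro x hx
    have hxabs : |x| ≤ lam := abs_le.mpr ⟨hx.1, hx.2.le⟩
    simp only [hf, if_pos hxabs]
    rcases le_or_gt 0 x with h | h
    · rw [abs_of_nonneg h, heven x ⟨by linarith, hx.2⟩]
    · rw [abs_of_neg h]
  have hfIoo : ∀ x ∈ Ioo (-lam) lam, f x = C * frobSol lam b x :=
    fun x hx ↦ hfIoc x ⟨hx.1, hx.2.le⟩
  have hfev : ∀ x ∈ Ioo (-lam) lam, f =ᶠ[𝓝 x] fun y ↦ C * frobSol lam b y := by
    intro x hx
    filter_upwards [Ioo_mem_nhds hx.1 hx.2] with y hy using hfIoo y hy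
  -- the zero set
  set Z := {x | x ∈ Ioo 0 lam ∧ frobSol lam b x = 0} with hZ
  have hZfin : Z.Finite := finite_zeros_frobSol hlam b
  have hZf : {x : ℝ | x ∈ Ioo (-lam) lam ∧ f x = 0} = Z ∪ (fun x ↦ -x) '' Z := by
    ext x
    simp only [mem_setOf_eq, mem_union, mem_image]
    constructor
    · rintro ⟨hx, hfx⟩
      rw [hfIoo x hx, mul_eq_zero] at hfx
      have hux := hfx.resolve_left hC0
      rcases lt_trichotomy x 0 with h | h | h
      · refine Or.inr ⟨-x, ⟨⟨by linarith, by linarith [hx.1]⟩, ?_⟩, neg_neg x⟩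
        rwa [heven x hx]
      · exact absurd (h ▸ hux) hA
      · exact Or.inl ⟨⟨h, hx.2⟩, hux⟩
    · rintro (⟨hx, hux⟩ | ⟨y, ⟨hy, huy⟩, rfl⟩)
      · have hx' : x ∈ Ioo (-lam) lam := ⟨by linarith [hx.1], hx.2⟩
        exact ⟨hx', by rw [hfIoo x hx', hux, mul_zero]⟩
      · have hy' : -y ∈ Ioo (-lam) lam := ⟨by linarith [hy.2], by linarith [hy.1]⟩
        refine ⟨hy', ?_⟩
        rw [hfIoo (-y) hy', heven y ⟨by linarith [hy.1], hy.2⟩, huy, mul_zero]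
  have heig : ∀ x ∈ Ioo (-lam) lam,
      -(deriv (fun y ↦ (lam ^ 2 - y ^ 2) * deriv f y) x) + (2 * π * lam * x) ^ 2 * f x
        = b * f x := by
    intro x hx
    have hd1 : ∀ y ∈ Ioo (-lam) lam, deriv f y = C * frobSol₁ lam b y := by
      intro y hy
      rw [(hfev y hy).deriv_eq]
      exact ((hsol.hasDerivAt y (Ioo_subset_Ioo_three hlam hy)).const_mul C).deriv
    have hflux : deriv (fun y ↦ (lam ^ 2 - y ^ 2) * deriv f y) x =
        C * (((2 * π * lam * x) ^ 2 - b) * frobSol lam b x) := by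
      have hev : (fun y ↦ (lam ^ 2 - y ^ 2) * deriv f y) =ᶠ[𝓝 x]
          fun y ↦ C * ((lam ^ 2 - y ^ 2) * frobSol₁ lam b y) := by
        filter_upwards [Ioo_mem_nhds hx.1 hx.2] with y hy
        rw [hd1 y hy]; ring
      rw [hev.deriv_eq]
      exact ((hsol.hasDerivAt_flux (Ioo_subset_Ioo_three hlam hx)).const_mul C).deriv
    rw [hflux, hfIoo x hx]
    ring

  refine ⟨⟨hlam, ?_, ⟨b, heig⟩, ?_, ?_, ?_, ?_, ?_⟩, heig⟩
  · -- C² on [−λ, λ]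
    intro x hx
    by_cases hxl : x < lam
    · -- use the reflected branch near `x`
      have hg : ContDiffAt ℝ 2 (fun y ↦ C * frobSol lam b (-y)) x := by
        have h1 : ContDiffAt ℝ 2 (frobSol lam b) (-x) :=
          (contDiffOn_frobSol hlam b).contDiffAt
            (Ioo_mem_nhds (by linarith [hx.2]) (by linarith [hx.1]))
        exact contDiffAt_const.mul (h1.comp x contDiffAt_id.neg)
      refine hg.contDiffWithinAt.congr_of_eventuallyEq ?_ (hfIco x ⟨hx.1, hxl⟩)
      filter_upwards [nhdsWithin_le_nhds (Iio_mem_nhds hxl), self_mem_nhdsWithin] with y hy1 hy2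
        using hfIco y ⟨hy2.1, hy1⟩
    · have hxl' : -lam < x := by linarith [not_lt.mp hxl]
      have hg : ContDiffAt ℝ 2 (fun y ↦ C * frobSol lam b y) x :=
        contDiffAt_const.mul ((contDiffOn_frobSol hlam b).contDiffAt
          (Ioo_mem_nhds hxl' (by linarith [hx.2])))
      refine hg.contDiffWithinAt.congr_of_eventuallyEq ?_ (hfIoc x ⟨hxl', hx.2⟩)
      filter_upwards [nhdsWithin_le_nhds (Ioi_mem_nhds hxl'), self_mem_nhdsWithin] with y hy1 hy2
        using hfIoc y ⟨hy1, hy2.2⟩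
  · -- support
    intro x hx
    simp only [hf, if_neg (not_le.mpr hx)]
  · rw [hZf]; exact hZfin.union (hZfin.image _)
  · rw [hZf, ncard_union_eq ?_ hZfin (hZfin.image _), ncard_image_of_injective _ neg_injective, hN]
    · ring
    · exact disjoint_left.mpr fun x hx ⟨y, hy, hxy⟩ ↦ by
        have := hy.1.1; have := hx.1.1; rw [← hxy] at this; linarith
  · -- normalisation
    have hcongr : EqOn (fun x ↦ f x ^ 2) (fun x ↦ C ^ 2 * frobSol lam b |x| ^ 2)
        (uIcc (-lam) lam) := by
      intro x hx
      rw [uIcc_of_le (by linarith)] at hx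
      have hxabs : |x| ≤ lam := abs_le.mpr ⟨hx.1, hx.2⟩
      simp only [hf, if_pos hxabs]
      ring
    rw [intervalIntegral.integral_congr hcongr, intervalIntegral.integral_const_mul]
    have habs : ContinuousOn (fun x ↦ frobSol lam b |x| ^ 2) (Icc (-lam) lam) := by
      refine (hcont.comp continuous_abs.continuousOn fun x hx ↦ ?_).pow 2
      exact ⟨abs_nonneg x, abs_le.mpr ⟨hx.1, hx.2⟩⟩
    have hi1 : IntervalIntegrable (fun x ↦ frobSol lam b |x| ^ 2) volume (-lam) 0 :=
      (habs.mono (Icc_subset_Icc le_rfl hlam.le)).intervalIntegrable_of_Icc (by linarith)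
    have hi2 : IntervalIntegrable (fun x ↦ frobSol lam b |x| ^ 2) volume 0 lam :=
      (habs.mono (Icc_subset_Icc (by linarith) le_rfl)).intervalIntegrable_of_Icc hlam.le
    rw [← intervalIntegral.integral_add_adjacent_intervals hi1 hi2]
    have hleft : ∫ x in (-lam)..0, frobSol lam b |x| ^ 2 = I := by
      have hc : EqOn (fun x ↦ frobSol lam b |x| ^ 2) (fun x ↦ frobSol lam b (-x) ^ 2)
          (uIcc (-lam) 0) := by
        intro x hx
        rw [uIcc_of_le (by linarith)] at hx
        simp only [abs_of_nonpos hx.2]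
      rw [intervalIntegral.integral_congr hc,
        intervalIntegral.integral_comp_neg (fun x ↦ frobSol lam b x ^ 2)]
      simp [hI]
    have hright : ∫ x in (0 : ℝ)..lam, frobSol lam b |x| ^ 2 = I := by
      have hc : EqOn (fun x ↦ frobSol lam b |x| ^ 2) (fun x ↦ frobSol lam b x ^ 2)
          (uIcc 0 lam) := by
        intro x hx
        rw [uIcc_of_le hlam.le] at hx
        simp only [abs_of_nonneg hx.1]
      rw [intervalIntegral.integral_congr hc]
    rw [hleft, hright]
    linear_combination hC2
  · -- positivity at `0`
    have : f 0 = s * frobSol lam b 0 / Real.sqrt (2 * I) := by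
      simp only [hf, abs_zero, if_pos hlam.le, hC]
      ring
    rw [this]
    exact div_pos hsA hsqrt


end Literature.NumberTheory.LFunctions

namespace Literature.NumberTheory.ConnesConsani2021

open Literature.NumberTheory.LFunctions

/-! ## `λ = 1`: the tree prolate vectors read off a critical Frobenius parameter -/

/-- The normalising constant `C_b = sign(u_b(0))/√(2∫₀¹u_b²)` of the even extension.
[cite: ConnesConsaniMoscovici2025, §7 (7.9)–(7.12); SlepianPollak1961, §III] -/
def frobNormConst (b : ℝ) : ℝ :=
  (if 0 < frobSol 1 b 0 then 1 else -1) / Real.sqrt (2 * ∫ x in (0 : ℝ)..1, frobSol 1 b x ^ 2)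

/-- The normalised even extension `x ↦ C_b·u_b(|x|)·𝟙_{|x| ≤ 1}` of the principal Frobenius
solution.
[cite: ConnesConsaniMoscovici2025, §7 (7.9)–(7.12); SlepianPollak1961, §III] -/
def frobEvenExt (b : ℝ) (x : ℝ) : ℝ :=
  if |x| ≤ 1 then frobNormConst b * frobSol 1 b |x| else 0

/-- `frobEvenExt` unfolds to the explicit lambda of `isProlateFunction_frobSol_evenExt`.
[folklore] -/
private theorem frobEvenExt_eq (b : ℝ) : frobEvenExt b = fun x ↦ if |x| ≤ (1 : ℝ) then
    (if 0 < frobSol 1 b 0 then 1 else -1) / Real.sqrt (2 * ∫ x in (0 : ℝ)..1, frobSol 1 b x ^ 2)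
      * frobSol 1 b |x| else 0 := by
  funext x; rfl

/-- **A critical parameter `b` (`u_b′(0) = 0`) with `k` zeros of `u_b` in `(0,1)` produces the
prolate function with `2k` zeros**, and its eigen-equation has `χ = b`.
[cite: SlepianPollak1961, §III; ConnesConsaniMoscovici2025, §7 (7.9)–(7.12)] -/
theorem isProlateFunction_frobEvenExt {b : ℝ} {k : ℕ} (hB : frobSol₁ 1 b 0 = 0)
    (hN : {x | x ∈ Ioo (0 : ℝ) 1 ∧ frobSol 1 b x = 0}.ncard = k) :
    IsProlateFunction 1 (2 * k) (frobEvenExt b) ∧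
      ∀ x ∈ Ioo (-1 : ℝ) 1, -(deriv (fun y ↦ (1 ^ 2 - y ^ 2) * deriv (frobEvenExt b) y) x)
        + (2 * π * 1 * x) ^ 2 * frobEvenExt b x = b * frobEvenExt b x := by
  have h := isProlateFunction_frobSol_evenExt one_pos hB hN
  rw [frobEvenExt_eq]
  simpa using h

/-- **`prolateFun k` IS the normalised even extension** at any critical parameter with `k` zeros
(uniqueness of prolate functions, `eq_prolateFun_of_isProlateFunction`).
[cite: ConnesConsani2021, §4 p. 16 (arXiv p0016:L17–L28); SlepianPollak1961, §III] -/
theorem prolateFun_eq_frobEvenExt {b : ℝ} {k : ℕ} (hB : frobSol₁ 1 b 0 = 0)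
    (hN : {x | x ∈ Ioo (0 : ℝ) 1 ∧ frobSol 1 b x = 0}.ncard = k) :
    prolateFun k = frobEvenExt b :=
  (eq_prolateFun_of_isProlateFunction (isProlateFunction_frobEvenExt hB hN).1).symm

/-- `C_b²·2∫₀¹u_b² = 1` and `C_b ≠ 0`. [folklore] -/
private theorem frobNormConst_sq (b : ℝ) :
    frobNormConst b ^ 2 * (2 * ∫ x in (0 : ℝ)..1, frobSol 1 b x ^ 2) = 1 ∧ frobNormConst b ≠ 0 := by
  have hI := integral_frobSol_sq_pos one_pos b
  have hs1 : (if 0 < frobSol 1 b 0 then (1 : ℝ) else -1) ^ 2 = 1 := by split_ifs <;> norm_num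
  have h1 : frobNormConst b ^ 2 * (2 * ∫ x in (0 : ℝ)..1, frobSol 1 b x ^ 2) = 1 := by
    rw [frobNormConst, div_pow, hs1, Real.sq_sqrt (by positivity)]
    field_simp
  refine ⟨h1, fun h ↦ ?_⟩
  rw [h] at h1; simp at h1

/-- `∫_{−1}^{1} C_b u_b(|x|) dx = 2 C_b ∫₀¹ u_b`. [folklore] -/
private theorem integral_frobEvenExt (b : ℝ) :
    ∫ x in (-1 : ℝ)..1, frobEvenExt b x
      = 2 * frobNormConst b * ∫ x in (0 : ℝ)..1, frobSol 1 b x := by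
  have hcont := continuousOn_frobSol_Icc one_pos b
  have hcongr : EqOn (frobEvenExt b) (fun x ↦ frobNormConst b * frobSol 1 b |x|)
      (uIcc (-1 : ℝ) 1) := by
    intro x hx
    rw [uIcc_of_le (by norm_num)] at hx
    have hxabs : |x| ≤ 1 := abs_le.mpr ⟨hx.1, hx.2⟩
    simp only [frobEvenExt, if_pos hxabs]
  rw [intervalIntegral.integral_congr hcongr, intervalIntegral.integral_const_mul]
  have habs : ContinuousOn (fun x ↦ frobSol 1 b |x|) (Icc (-1 : ℝ) 1) := by
    refine hcont.comp continuous_abs.continuousOn fun x hx ↦ ?_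
    exact ⟨abs_nonneg x, abs_le.mpr ⟨hx.1, hx.2⟩⟩
  have hi1 : IntervalIntegrable (fun x ↦ frobSol 1 b |x|) volume (-1 : ℝ) 0 :=
    (habs.mono (Icc_subset_Icc le_rfl zero_le_one)).intervalIntegrable_of_Icc (by norm_num)
  have hi2 : IntervalIntegrable (fun x ↦ frobSol 1 b |x|) volume (0 : ℝ) 1 :=
    (habs.mono (Icc_subset_Icc (by norm_num) le_rfl)).intervalIntegrable_of_Icc zero_le_one
  rw [← intervalIntegral.integral_add_adjacent_intervals hi1 hi2]
  have hleft : ∫ x in (-1 : ℝ)..0, frobSol 1 b |x| = ∫ x in (0 : ℝ)..1, frobSol 1 b x := by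
    have hc : EqOn (fun x ↦ frobSol 1 b |x|) (fun x ↦ frobSol 1 b (-x)) (uIcc (-1 : ℝ) 0) := by
      intro x hx
      rw [uIcc_of_le (by norm_num)] at hx
      simp only [abs_of_nonpos hx.2]
    rw [intervalIntegral.integral_congr hc,
      intervalIntegral.integral_comp_neg (fun x ↦ frobSol 1 b x)]
    simp
  have hright : ∫ x in (0 : ℝ)..1, frobSol 1 b |x| = ∫ x in (0 : ℝ)..1, frobSol 1 b x := by
    refine intervalIntegral.integral_congr fun x hx ↦ ?_
    rw [uIcc_of_le zero_le_one] at hx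
    simp only [abs_of_nonneg hx.1]
  rw [hleft, hright]
  ring

/-- **`λ(k) = 2∫₀¹u_b / u_b(0)`** — the tree eigenvalue read off the Frobenius solution at a
critical parameter (normalisation-free).
[cite: ConnesConsani2021, §4 p. 16 eq. (cosalphan) (arXiv p0016:L25–L28): "λ(n) = ∫φ_n / φ_n(0)"] -/
theorem prolateEigen_eq_of_frobSol {b : ℝ} {k : ℕ} (hB : frobSol₁ 1 b 0 = 0)
    (hN : {x | x ∈ Ioo (0 : ℝ) 1 ∧ frobSol 1 b x = 0}.ncard = k) :
    prolateEigen k = 2 * (∫ x in (0 : ℝ)..1, frobSol 1 b x) / frobSol 1 b 0 := by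
  obtain ⟨-, hC0⟩ := frobNormConst_sq b
  rw [prolateEigen_eq_intervalIntegral, prolateFun_eq_frobEvenExt hB hN, integral_frobEvenExt]
  have h0 : frobEvenExt b 0 = frobNormConst b * frobSol 1 b 0 := by
    simp [frobEvenExt]
  rw [h0, mul_comm (2 : ℝ), mul_assoc, mul_div_mul_left _ _ hC0]

/-- **`ψ_k(1)² = 1/(2∫₀¹u_b²)`** (`u_b(1) = 1`).
[cite: ConnesConsani2021, Lemma 5.4 §5 p. 32 ("ξ_n(1)²"); App. E eq. (100)] -/
theorem prolateFun_one_sq_eq_of_frobSol {b : ℝ} {k : ℕ} (hB : frobSol₁ 1 b 0 = 0)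
    (hN : {x | x ∈ Ioo (0 : ℝ) 1 ∧ frobSol 1 b x = 0}.ncard = k) :
    prolateFun k 1 ^ 2 = 1 / (2 * ∫ x in (0 : ℝ)..1, frobSol 1 b x ^ 2) := by
  obtain ⟨hC2, -⟩ := frobNormConst_sq b
  have hI := integral_frobSol_sq_pos one_pos b
  rw [prolateFun_eq_frobEvenExt hB hN]
  have h1 : frobEvenExt b 1 = frobNormConst b := by
    simp [frobEvenExt, frobSol_self]
  rw [h1, eq_div_iff (by positivity), hC2]

/-- **`t(k)` from Frobenius data**: `t(k) = 2L²/(1−L²) · 1/(2I₂)` with `L = 2I₁/u_b(0)`,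
`I₁ = ∫₀¹u_b`, `I₂ = ∫₀¹u_b²`.
[cite: ConnesConsani2021, Lemma 5.4 §5 p. 32 (arXiv item Lemma 31)] -/
theorem epsSlopeTerm_prolateFun_eq_of_frobSol {b : ℝ} {k : ℕ} (hB : frobSol₁ 1 b 0 = 0)
    (hN : {x | x ∈ Ioo (0 : ℝ) 1 ∧ frobSol 1 b x = 0}.ncard = k) :
    epsSlopeTerm (prolateFun k)
      = 2 * (2 * (∫ x in (0 : ℝ)..1, frobSol 1 b x) / frobSol 1 b 0) ^ 2
          / (1 - (2 * (∫ x in (0 : ℝ)..1, frobSol 1 b x) / frobSol 1 b 0) ^ 2)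
          * (1 / (2 * ∫ x in (0 : ℝ)..1, frobSol 1 b x ^ 2)) := by
  rw [epsSlopeTerm, prolateFun_one_sq_eq_of_frobSol hB hN,
    show prolateLambda (prolateFun k) = prolateEigen k from rfl, prolateEigen_eq_of_frobSol hB hN]

/-- **Distinct critical parameters give distinct members** (so a certificate never counts zeros):
if `b ≠ b'` are both critical then the zero counts differ.
[cite: SlepianPollak1961, §III; ConnesConsaniMoscovici2025, §7 (7.9)–(7.12)] -/
theorem ne_of_frobSol_critical {b b' : ℝ} {k k' : ℕ} (hB : frobSol₁ 1 b 0 = 0)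
    (hN : {x | x ∈ Ioo (0 : ℝ) 1 ∧ frobSol 1 b x = 0}.ncard = k) (hB' : frobSol₁ 1 b' 0 = 0)
    (hN' : {x | x ∈ Ioo (0 : ℝ) 1 ∧ frobSol 1 b' x = 0}.ncard = k') (hbb : b ≠ b') : k ≠ k' := by
  intro hkk
  subst hkk
  obtain ⟨hP, heig⟩ := isProlateFunction_frobEvenExt hB hN
  obtain ⟨-, heig'⟩ := isProlateFunction_frobEvenExt hB' hN'
  have hff : frobEvenExt b' = frobEvenExt b := by
    rw [← prolateFun_eq_frobEvenExt hB hN, ← prolateFun_eq_frobEvenExt hB' hN']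
  have h0 : (0 : ℝ) ∈ Ioo (-1 : ℝ) 1 := ⟨by norm_num, by norm_num⟩
  have e1 := heig 0 h0
  have e2 := heig' 0 h0
  rw [hff] at e2
  have hpos : 0 < frobEvenExt b 0 := hP.pos_zero
  have : b * frobEvenExt b 0 = b' * frobEvenExt b 0 := by rw [← e1, ← e2]
  exact hbb (mul_right_cancel₀ hpos.ne' this)

end Literature.NumberTheory.ConnesConsani2021

end
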